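import Literature.Probability.Percolation.TwoSetConditionalAssociation
import Summits.CriticalPhenomena.PercolationContinuityZ3.Theorems.PercNearOneGluingNearOneGluingBhkLogSupermodular
import HarnessLib

/-!
# Two-copy hard-core structure of the percolation cluster: the push-forward weights, the hard-core kernel, and
# "downward FKG of `C_S` on `{S ↮ T}`" = van den Berg–Häggström–Kahn's Theorem 1.3 with sets

Support file (prover prim-facecert gen 14; `--supports stmt-CriticalPhenomena-4575`); builds on the lead seat
prim-nh-lead-4575's gen-105 programme (memo `run/shared/lean/prim/prim-nh-lead-4575/LEAD-GEN105.md` §1(6): conjecture (HC)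
"hard-core Harris", its reduction to PA-BERN = `Consts.FibrewiseBHK`, and the pencil proof of the MEASURE-LEVEL two-copy
statement by an averaging-operator iteration; `|N| = 1` in the kernel: `…ConstsHardCoreHarrisOne`).  No definitions, no named
facts, no sorries; standard axioms.

Bond percolation `μ = prodBernoulli w` with arbitrary edge probabilities on a finite vertex type (finite-sum language of
`ConditionalPositiveAssociationProofs.lean`: `BHK2006.weight`, `DecisionTree.ind`), a source set `S`, a repelled set `T`
(`D = {S ↮ T}`), a hard-core set `N`, the union cluster `C_S(ω) = ⋃_{s ∈ S} C_s(ω)` (edge sets).  This file supplies the data of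
the abstract two-copy theorem (`…ConstsTwoCopyDownwardFKG*`) for `α = Set (Sym2 V)` ordered by inclusion:
* `sum_fiber`, `sum_fiber₂`, `pair_sum_cluster` — regrouping configuration sums along the fibres of `ω ↦ C_S(ω)`
  (push-forward weights `p W = Σ_ω w(ω) 1_D(ω) [C_S(ω) = W]`);
* `setIntegral_eq_sum_ind`, `bhk_set_pa_sum` — the tree's `BHK2006_setClusterConditionalPositiveAssociation` (BHK Thm. 2.1 at
  `q = 1` = Thm. 1.3/1.5 with sets) in finite-sum form;
* `exists_reachable_iff_cluster`, `kernel_cluster`, `kernel_props`, `bottom_compat`, `bottom_mass` — the hard-core kernel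
  `κ W W' = 1{no v ∈ N is reached by both W and W'}` (a set of edges `W` REACHES `v` iff `v ∈ S ∨ ∃ e ∈ W, v ∈ e`) is `0/1`,
  symmetric, antitone; at two clusters it is the two-copy indicator `1{no v ∈ N is joined to S in both copies}`; clusters reaching
  no vertex of `N` are compatible with everything and have total weight `w(S ↮ T ∪ N)`;
* `pa_partner` — THE DOWNWARD-FKG HYPOTHESIS: for each partner `W₂`, `p W · κ W W₂` is the law of `C_S` on `{S ↮ T ∪ N(W₂)}`, on which
  monotone functions of `C_S` are positively correlated (BHK Thm. 1.3 with sets);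
* `degenerate` — if `w(S ↮ T ∪ N) = 0` every two-copy term vanishes (the configuration of the a.s.-open edges joins `S` to `T ∪ N`).
All objects (`D`, `C`, `p`, `κ`) are passed as variables with defining equations; no definition is introduced.
[cite: VandenbergHaggstromKahn2005, Thm. 2.1 (p. 9) at q = 1, Remark 1 after Thm. 1.2 (p. 5), Thm. 1.3 (p. 6)]
-/

noncomputable section

namespace Summit.CriticalPhenomena.PercolationContinuityZ3.Theorems

namespace TwoCopyHardCore

open MeasureTheory Set Finset
open Literature.Probability.LatticeModels (prodBernoulli)
open Literature.Probability.Percolation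
open Literature.Probability.Percolation.BHK2006
open DecisionTree (ind ind_of_mem ind_of_not_mem ind_nonneg)
open scoped Classical

/-! ### Percolation bookkeeping -/

section Fiber

variable {Ω γ : Type*} [Fintype Ω] [Fintype γ]

/-- **Regrouping a weighted sum along the fibres of a map** (`f = C_S`, the cluster): with the push-forward weights
`p a = Σ_x u x·[f x = a]`, `Σ_a p a Φ a = Σ_x u x Φ (f x)`. [folklore] -/
theorem sum_fiber (u : Ω → ℝ) (f : Ω → γ) (Φ : γ → ℝ) :
    ∑ a, (∑ x, u x * (if f x = a then (1 : ℝ) else 0)) * Φ a = ∑ x, u x * Φ (f x) := by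
  simp_rw [Finset.sum_mul]
  rw [Finset.sum_comm]
  refine Finset.sum_congr rfl fun x _ => ?_
  have e : ∑ a, u x * (if f x = a then (1 : ℝ) else 0) * Φ a = ∑ a, (if f x = a then u x * Φ a else 0) :=
    Finset.sum_congr rfl fun a _ => by split_ifs <;> ring
  rw [e, Finset.sum_ite_eq]
  simp

/-- The two-variable version of `sum_fiber`. [folklore] -/
theorem sum_fiber₂ (u : Ω → ℝ) (f : Ω → γ) (Ψ : γ → γ → ℝ) :
    ∑ a, ∑ b, (∑ x, u x * (if f x = a then (1 : ℝ) else 0)) * (∑ x, u x * (if f x = b then (1 : ℝ) else 0)) *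
        Ψ a b = ∑ x, ∑ y, u x * u y * Ψ (f x) (f y) := by
  have inner : ∀ a, ∑ b, (∑ x, u x * (if f x = a then (1 : ℝ) else 0)) *
      (∑ x, u x * (if f x = b then (1 : ℝ) else 0)) * Ψ a b =
      (∑ x, u x * (if f x = a then (1 : ℝ) else 0)) * ∑ y, u y * Ψ a (f y) := by
    intro a
    rw [← sum_fiber u f (Ψ a), Finset.mul_sum]
    exact Finset.sum_congr rfl fun b _ => by ring
  simp_rw [inner]
  rw [sum_fiber u f (fun a => ∑ y, u y * Ψ a (f y))]
  exact Finset.sum_congr rfl fun x _ => by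
    rw [Finset.mul_sum]; exact Finset.sum_congr rfl fun y _ => by ring

end Fiber

variable {V : Type*} [Fintype V]

/-- A set integral against `prodBernoulli w` on the finite configuration space is a weighted finite sum.
[folklore] -/
theorem setIntegral_eq_sum_ind (w : Sym2 V → unitInterval) (D : Set (BondConfig V)) (h : BondConfig V → ℝ) :
    ∫ ω in D, h ω ∂(prodBernoulli w) = ∑ ω, weight (fun e => (w e : ℝ)) ω * (ind D ω * h ω) := by
  rw [← integral_indicator (MeasurableSet.of_discrete (s := D)), integral_prodBernoulli_eq_sum]
  refine Finset.sum_congr rfl fun ω _ => ?_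
  by_cases hω : ω ∈ D
  · rw [Set.indicator_of_mem hω, ind_of_mem hω, one_mul]
  · rw [Set.indicator_of_notMem hω, ind_of_not_mem hω, zero_mul, mul_zero]

/-- **BHK's Theorem 1.3 with vertex sets, finite-sum form**: on `D = {S ↮ T}` monotone functions of the union
cluster `C_S = ⋃_{s ∈ S} C_s` are positively correlated,
`(Σ w·1_D·F(C_S))(Σ w·1_D·G(C_S)) ≤ (Σ w·1_D)(Σ w·1_D·F(C_S)G(C_S))` — the tree's
`BHK2006_setClusterConditionalPositiveAssociation` rewritten with `integral_prodBernoulli_eq_sum`.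
[cite: VandenbergHaggstromKahn2005, Thm. 2.1 (p. 9) at q = 1 with Remark 1 after Thm. 1.2 (p. 5)] -/
theorem bhk_set_pa_sum (w : Sym2 V → unitInterval) (S T : Set V) (F G : Set (Sym2 V) → ℝ)
    (hF : Monotone F) (hG : Monotone G) :
    (∑ ω, weight (fun e => (w e : ℝ)) ω *
        (ind {ω : BondConfig V | ∀ s ∈ S, ∀ t ∈ T, ¬ (openGraph ω).Reachable s t} ω *
          F (⋃ s ∈ S, openEdgeCluster ω s))) *
      (∑ ω, weight (fun e => (w e : ℝ)) ω *
        (ind {ω : BondConfig V | ∀ s ∈ S, ∀ t ∈ T, ¬ (openGraph ω).Reachable s t} ω *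
          G (⋃ s ∈ S, openEdgeCluster ω s))) ≤
    (∑ ω, weight (fun e => (w e : ℝ)) ω *
        ind {ω : BondConfig V | ∀ s ∈ S, ∀ t ∈ T, ¬ (openGraph ω).Reachable s t} ω) *
      (∑ ω, weight (fun e => (w e : ℝ)) ω *
        (ind {ω : BondConfig V | ∀ s ∈ S, ∀ t ∈ T, ¬ (openGraph ω).Reachable s t} ω *
          (F (⋃ s ∈ S, openEdgeCluster ω s) * G (⋃ s ∈ S, openEdgeCluster ω s)))) := by
  have h := BHK2006_setClusterConditionalPositiveAssociation w S T F G hF hG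
  rw [setIntegral_eq_sum_ind, setIntegral_eq_sum_ind, setIntegral_eq_sum_ind,
    prodBernoulli_real_eq_sum_weight_ind] at h
  simpa only [mul_one] using h

omit [Fintype V] in
/-- `S ↔ v` read off the union cluster: some vertex of `S` is joined to `v` iff `v ∈ S` or some edge of
`C_S = ⋃_{s ∈ S} C_s` contains `v`. [folklore] -/
theorem exists_reachable_iff_cluster (S : Set V) (ω : BondConfig V) (v : V) :
    (∃ s ∈ S, (openGraph ω).Reachable s v) ↔ (v ∈ S ∨ ∃ e ∈ ⋃ s ∈ S, openEdgeCluster ω s, v ∈ e) := by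
  have h := TwoSetConditionalAssociation.setOf_mem_or_exists_mem_biUnion_openEdgeCluster S v
  have h' := Set.ext_iff.1 h ω
  simp only [mem_setOf_eq, mem_iUnion, exists_prop, openConn] at h'
  simp only [mem_iUnion, exists_prop]
  exact h'.symm


/-! ### The two-copy hard-core structure of the union cluster `C_S` on `{S ↮ T}`

Throughout: weights `w`, source set `S`, repelled set `T`, hard-core set `N`; `D = {S ↮ T}`;
`C ω = C_S(ω) = ⋃_{s ∈ S} C_s(ω)`; the push-forward weights `p W = Σ_ω w(ω) 1_D(ω) [C ω = W]` of the cluster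
on `D`; a set of edges `W` *reaches* `v` if `v ∈ S ∨ ∃ e ∈ W, v ∈ e`; the hard-core kernel
`κ W W' = 1{no v ∈ N is reached by both W and W'}`.  All objects are passed as variables with their defining
equations (`hD`, `hC`, `hp`, `hκ`), so that no definition is introduced. -/

section Percolation

variable (w : Sym2 V → unitInterval) (S T N : Set V)
  (D : Set (BondConfig V)) (hD : ∀ ω, ω ∈ D ↔ ∀ s ∈ S, ∀ t ∈ T, ¬ (openGraph ω).Reachable s t)
  (C : BondConfig V → Set (Sym2 V)) (hC : ∀ ω, C ω = ⋃ s ∈ S, openEdgeCluster ω s)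
  (p : Set (Sym2 V) → ℝ)
  (hp : ∀ W, p W = ∑ ω, weight (fun e => (w e : ℝ)) ω * ind D ω * (if C ω = W then (1 : ℝ) else 0))
  (κ : Set (Sym2 V) → Set (Sym2 V) → ℝ)
  (hκ : ∀ W W', κ W W' =
    if ∀ v ∈ N, ¬ ((v ∈ S ∨ ∃ e ∈ W, v ∈ e) ∧ (v ∈ S ∨ ∃ e ∈ W', v ∈ e)) then (1 : ℝ) else 0)

include hC hκ in
/-- The hard-core kernel evaluated at two clusters is the two-copy hard-core indicator
`1{no v ∈ N is joined to S in both configurations}`. [folklore] -/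
theorem kernel_cluster (ω ω' : BondConfig V) :
    κ (C ω) (C ω') = if ∀ v ∈ N, ¬ ((∃ s ∈ S, (openGraph ω).Reachable s v) ∧
      ∃ s ∈ S, (openGraph ω').Reachable s v) then (1 : ℝ) else 0 := by
  rw [hκ, hC ω, hC ω']
  simp only [← exists_reachable_iff_cluster]

include hκ in
/-- The hard-core kernel takes the values `0, 1`, is symmetric, and is antitone in each argument. [folklore] -/
theorem kernel_props :
    (∀ W W', κ W W' = 0 ∨ κ W W' = 1) ∧ (∀ W W', κ W W' = κ W' W) ∧
      (∀ W₂, Antitone (fun W => κ W W₂)) := by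
  refine ⟨fun W W' => ?_, fun W W' => ?_, fun W₂ W W' hWW' => ?_⟩
  · rw [hκ]; split_ifs
    · exact Or.inr rfl
    · exact Or.inl rfl
  · rw [hκ, hκ]
    simp only [and_comm]
  · show κ W' W₂ ≤ κ W W₂
    rw [hκ, hκ]
    by_cases h : ∀ v ∈ N, ¬ ((v ∈ S ∨ ∃ e ∈ W', v ∈ e) ∧ (v ∈ S ∨ ∃ e ∈ W₂, v ∈ e))
    · have h' : ∀ v ∈ N, ¬ ((v ∈ S ∨ ∃ e ∈ W, v ∈ e) ∧ (v ∈ S ∨ ∃ e ∈ W₂, v ∈ e)) := by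
        intro v hv ⟨h1, h2⟩
        exact h v hv ⟨h1.imp id fun ⟨e, he, hve⟩ => ⟨e, hWW' he, hve⟩, h2⟩
      rw [if_pos h, if_pos h']
    · rw [if_neg h]; split_ifs <;> norm_num

include hD hC hp hκ in
/-- **The "downward FKG" hypothesis for the cluster = BHK's Theorem 1.3 with sets.**  For every partner `W₂`, under the
weights `p W · κ W W₂` (the cluster on `{S ↮ T}`, conditioned to reach no vertex of `N` reached by `W₂`, i.e. on
`{S ↮ T ∪ N(W₂)}`), monotone functions of the cluster are positively correlated.
[cite: VandenbergHaggstromKahn2005, Thm. 2.1 (p. 9) at q = 1 with Remark 1 after Thm. 1.2 (p. 5)] -/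
theorem pa_partner (W₂ : Set (Sym2 V)) (F G : Set (Sym2 V) → ℝ) (hF : Monotone F) (hG : Monotone G) :
    (∑ W, p W * κ W W₂ * F W) * (∑ W, p W * κ W W₂ * G W) ≤
      (∑ W, p W * κ W W₂) * (∑ W, p W * κ W W₂ * (F W * G W)) := by
  -- the event `{S ↮ T ∪ N(W₂)}`
  set D₂ : Set (BondConfig V) := {ω | ∀ s ∈ S, ∀ t ∈ T ∪ {v | v ∈ N ∧ (v ∈ S ∨ ∃ e ∈ W₂, v ∈ e)},
    ¬ (openGraph ω).Reachable s t} with hD₂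
  have hind : ∀ ω, weight (fun e => (w e : ℝ)) ω * ind D ω * κ (C ω) W₂ =
      weight (fun e => (w e : ℝ)) ω * ind D₂ ω := by
    intro ω
    have key : ω ∈ D₂ ↔ ω ∈ D ∧ ∀ v ∈ N, ¬ ((v ∈ S ∨ ∃ e ∈ C ω, v ∈ e) ∧ (v ∈ S ∨ ∃ e ∈ W₂, v ∈ e)) := by
      rw [hD ω, hC ω]
      simp only [hD₂, mem_setOf_eq, Set.mem_union, ← exists_reachable_iff_cluster]
      constructor
      · intro h
        refine ⟨fun s hs t ht => h s hs t (Or.inl ht), fun v hv ⟨⟨s, hs, hsv⟩, h2⟩ => h s hs v (Or.inr ⟨hv, h2⟩) hsv⟩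
      · rintro ⟨h1, h2⟩ s hs t (ht | ⟨htN, ht2⟩)
        · exact h1 s hs t ht
        · exact fun hst => h2 t htN ⟨⟨s, hs, hst⟩, ht2⟩
    rw [mul_assoc]
    congr 1
    rw [hκ]
    by_cases h1 : ω ∈ D
    · by_cases h2 : ∀ v ∈ N, ¬ ((v ∈ S ∨ ∃ e ∈ C ω, v ∈ e) ∧ (v ∈ S ∨ ∃ e ∈ W₂, v ∈ e))
      · rw [ind_of_mem h1, if_pos h2, ind_of_mem (key.2 ⟨h1, h2⟩), one_mul]
      · rw [if_neg h2, mul_zero, ind_of_not_mem (fun h => h2 (key.1 h).2)]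
    · rw [ind_of_not_mem h1, zero_mul, ind_of_not_mem (fun h => h1 (key.1 h).1)]
  -- the four sums are sums over configurations on `D₂`
  have hsum : ∀ Φ : Set (Sym2 V) → ℝ, ∑ W, p W * κ W W₂ * Φ W =
      ∑ ω, weight (fun e => (w e : ℝ)) ω * (ind D₂ ω * Φ (⋃ s ∈ S, openEdgeCluster ω s)) := by
    intro Φ
    have e1 : ∑ W, p W * κ W W₂ * Φ W =
        ∑ W, (∑ ω, weight (fun e => (w e : ℝ)) ω * ind D ω * (if C ω = W then (1 : ℝ) else 0)) *
          (κ W W₂ * Φ W) := Finset.sum_congr rfl fun W _ => by rw [hp W]; ring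
    rw [e1]
    refine (sum_fiber (fun ω => weight (fun e => (w e : ℝ)) ω * ind D ω) C (fun W => κ W W₂ * Φ W)).trans ?_
    exact Finset.sum_congr rfl fun ω _ => by rw [← mul_assoc, hind ω, hC ω, mul_assoc]
  have hsum1 : ∑ W, p W * κ W W₂ = ∑ ω, weight (fun e => (w e : ℝ)) ω * ind D₂ ω := by
    have := hsum (fun _ => 1)
    simp only [mul_one] at this
    exact this
  rw [hsum F, hsum G, hsum (fun W => F W * G W), hsum1]
  exact bhk_set_pa_sum w S _ F G hF hG

include hκ in
/-- Clusters reaching no vertex of `N` are compatible with every partner. [folklore] -/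
theorem bottom_compat (W : Set (Sym2 V)) (hW : ∀ v ∈ N, ¬ (v ∈ S ∨ ∃ e ∈ W, v ∈ e)) (W' : Set (Sym2 V)) :
    κ W W' = 1 := by
  rw [hκ, if_pos (fun v hv h => hW v hv h.1)]

include hD hC hp in
/-- The `p`-mass of the clusters reaching no vertex of `N` is the weight of `{S ↮ T ∪ N}`. [folklore] -/
theorem bottom_mass :
    ∑ W ∈ Finset.univ.filter (fun W : Set (Sym2 V) => ∀ v ∈ N, ¬ (v ∈ S ∨ ∃ e ∈ W, v ∈ e)), p W =
      ∑ ω, weight (fun e => (w e : ℝ)) ω *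
        ind {ω : BondConfig V | ∀ s ∈ S, ∀ t ∈ T ∪ N, ¬ (openGraph ω).Reachable s t} ω := by
  rw [Finset.sum_filter]
  have e1 : ∑ W, (if (∀ v ∈ N, ¬ (v ∈ S ∨ ∃ e ∈ W, v ∈ e)) then p W else 0) =
      ∑ W, (∑ ω, weight (fun e => (w e : ℝ)) ω * ind D ω * (if C ω = W then (1 : ℝ) else 0)) *
        (if (∀ v ∈ N, ¬ (v ∈ S ∨ ∃ e ∈ W, v ∈ e)) then (1 : ℝ) else 0) :=
    Finset.sum_congr rfl fun W _ => by rw [hp W]; split_ifs <;> ring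
  rw [e1]
  refine (sum_fiber (fun ω => weight (fun e => (w e : ℝ)) ω * ind D ω) C _).trans ?_
  refine Finset.sum_congr rfl fun ω _ => ?_
  rw [mul_assoc]
  congr 1
  have key : (ω ∈ D ∧ ∀ v ∈ N, ¬ (v ∈ S ∨ ∃ e ∈ C ω, v ∈ e)) ↔
      ω ∈ {ω : BondConfig V | ∀ s ∈ S, ∀ t ∈ T ∪ N, ¬ (openGraph ω).Reachable s t} := by
    rw [hD ω, hC ω]
    simp only [mem_setOf_eq, Set.mem_union, ← exists_reachable_iff_cluster, not_exists, not_and]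
    constructor
    · rintro ⟨h1, h2⟩ s hs t (ht | ht)
      · exact h1 s hs t ht
      · exact h2 t ht s hs
    · intro h
      exact ⟨fun s hs t ht => h s hs t (Or.inl ht), fun v hv s hs => h s hs v (Or.inr hv)⟩
  by_cases h1 : ω ∈ D
  · by_cases h2 : ∀ v ∈ N, ¬ (v ∈ S ∨ ∃ e ∈ C ω, v ∈ e)
    · rw [ind_of_mem h1, if_pos h2, ind_of_mem (key.1 ⟨h1, h2⟩), one_mul]
    · rw [if_neg h2, mul_zero, ind_of_not_mem (fun h => h2 (key.2 h).2)]
  · rw [ind_of_not_mem h1, zero_mul, ind_of_not_mem (fun h => h1 (key.2 h).1)]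

include hC hp in
/-- Pair sums against the push-forward weights are pair sums over configurations. [folklore] -/
theorem pair_sum_cluster (Ψ : Set (Sym2 V) → Set (Sym2 V) → ℝ) :
    ∑ W, ∑ W', p W * p W' * Ψ W W' =
      ∑ ω, ∑ ω', weight (fun e => (w e : ℝ)) ω * weight (fun e => (w e : ℝ)) ω' *
        (ind D ω * ind D ω') * Ψ (⋃ s ∈ S, openEdgeCluster ω s) (⋃ s ∈ S, openEdgeCluster ω' s) := by
  have e1 : ∑ W, ∑ W', p W * p W' * Ψ W W' =
      ∑ W, ∑ W', (∑ ω, weight (fun e => (w e : ℝ)) ω * ind D ω * (if C ω = W then (1 : ℝ) else 0)) *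
        (∑ ω, weight (fun e => (w e : ℝ)) ω * ind D ω * (if C ω = W' then (1 : ℝ) else 0)) * Ψ W W' :=
    Finset.sum_congr rfl fun W _ => Finset.sum_congr rfl fun W' _ => by rw [hp W, hp W']
  rw [e1]
  refine (sum_fiber₂ (fun ω => weight (fun e => (w e : ℝ)) ω * ind D ω) C Ψ).trans ?_
  exact Finset.sum_congr rfl fun ω _ => Finset.sum_congr rfl fun ω' _ => by
    rw [hC ω, hC ω']; ring

end Percolation

/-! ### The degenerate case `w({S ↮ T ∪ N}) = 0` -/

/-- If `{S ↮ T ∪ N}` is null, every two-copy term `w(ω) w(ω') 1_D(ω) 1_D(ω') 1_{HC}(ω, ω')` vanishes: the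
configuration of the almost surely open edges already joins `S` to `T ∪ N`, hence so does every configuration of
positive weight. [folklore] -/
theorem degenerate (w : Sym2 V → unitInterval) (S T N : Set V)
    (D : Set (BondConfig V)) (hD : ∀ ω, ω ∈ D ↔ ∀ s ∈ S, ∀ t ∈ T, ¬ (openGraph ω).Reachable s t)
    (h0 : ∑ ω, weight (fun e => (w e : ℝ)) ω *
      ind {ω : BondConfig V | ∀ s ∈ S, ∀ t ∈ T ∪ N, ¬ (openGraph ω).Reachable s t} ω = 0)
    (ω ω' : BondConfig V) :
    weight (fun e => (w e : ℝ)) ω * weight (fun e => (w e : ℝ)) ω' * (ind D ω * ind D ω' *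
      (if ∀ v ∈ N, ¬ ((∃ s ∈ S, (openGraph ω).Reachable s v) ∧ ∃ s ∈ S, (openGraph ω').Reachable s v)
        then (1 : ℝ) else 0)) = 0 := by
  have hw0 : ∀ e, 0 ≤ (w e : ℝ) := fun e => (w e).2.1
  have hw1 : ∀ e, (w e : ℝ) ≤ 1 := fun e => (w e).2.2
  -- the configuration of the almost surely open edges
  set ω₁ : BondConfig V := {e | (w e : ℝ) = 1} with hω₁
  have hpos : 0 < weight (fun e => (w e : ℝ)) ω₁ := by
    unfold weight
    refine Finset.prod_pos fun e _ => ?_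
    by_cases he : e ∈ ω₁
    · rw [if_pos he]; dsimp only; have h1 : (w e : ℝ) = 1 := he; rw [h1]; norm_num
    · rw [if_neg he]; dsimp only
      have h1 : (w e : ℝ) ≠ 1 := he
      exact sub_pos.2 (lt_of_le_of_ne (hw1 e) h1)
  have hsub : ∀ η : BondConfig V, weight (fun e => (w e : ℝ)) η ≠ 0 → ω₁ ⊆ η := by
    intro η hη e he
    by_contra hne
    apply hη
    unfold weight
    apply Finset.prod_eq_zero (Finset.mem_univ e)
    rw [if_neg hne]; dsimp only
    have h1 : (w e : ℝ) = 1 := he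
    rw [h1]; norm_num
  -- `ω₁` joins `S` to `T ∪ N`
  have hterm : weight (fun e => (w e : ℝ)) ω₁ *
      ind {ω : BondConfig V | ∀ s ∈ S, ∀ t ∈ T ∪ N, ¬ (openGraph ω).Reachable s t} ω₁ = 0 := by
    have hnn : ∀ η ∈ (Finset.univ : Finset (BondConfig V)), 0 ≤ weight (fun e => (w e : ℝ)) η *
        ind {ω : BondConfig V | ∀ s ∈ S, ∀ t ∈ T ∪ N, ¬ (openGraph ω).Reachable s t} η :=
      fun η _ => mul_nonneg (weight_nonneg hw0 hw1 η) (ind_nonneg _ _)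
    exact (Finset.sum_eq_zero_iff_of_nonneg hnn).1 h0 ω₁ (Finset.mem_univ _)
  have hreach : ∃ s ∈ S, ∃ t ∈ T ∪ N, (openGraph ω₁).Reachable s t := by
    by_contra hne
    push Not at hne
    have hmem : ω₁ ∈ {ω : BondConfig V | ∀ s ∈ S, ∀ t ∈ T ∪ N, ¬ (openGraph ω).Reachable s t} := hne
    rw [ind_of_mem hmem, mul_one] at hterm
    exact absurd hterm (ne_of_gt hpos)
  obtain ⟨s, hs, t, ht, hst⟩ := hreach
  -- case analysis on the weights of `ω, ω'`
  by_cases hω : weight (fun e => (w e : ℝ)) ω = 0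
  · rw [hω]; ring
  by_cases hω' : weight (fun e => (w e : ℝ)) ω' = 0
  · rw [hω']; ring
  have h1 : (openGraph ω).Reachable s t := hst.mono (openGraph_le (hsub ω hω))
  have h2 : (openGraph ω').Reachable s t := hst.mono (openGraph_le (hsub ω' hω'))
  rcases ht with ht | ht
  · have : ω ∉ D := fun h => (hD ω).1 h s hs t ht h1
    rw [ind_of_not_mem this]; ring
  · have : ¬ ∀ v ∈ N, ¬ ((∃ s ∈ S, (openGraph ω).Reachable s v) ∧ ∃ s ∈ S, (openGraph ω').Reachable s v) :=
      fun h => h t ht ⟨⟨s, hs, h1⟩, ⟨s, hs, h2⟩⟩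
    rw [if_neg this]; ring

end TwoCopyHardCore

end Summit.CriticalPhenomena.PercolationContinuityZ3.Theorems
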